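import Summits.BirchSwinnertonDyer.BirchSwinnertonDyer.Theorems.PrintCf2SplitBadTwoLocalPointIndexAtV
import HarnessLib

/-!
# Crux `PrintCf2.SplitBadTwoRankOneOfFacts` (stmt-BirchSwinnertonDyer-20368), road α v10.3, S3c factor (F3), plain road:
# THE POINT-INDEX CORE IN THE `Affine.Point.baseChange K K_v` / `zsmulAddGroupHom` CURRENCY of -w8 g3's (PI)

Cell `bsd-print-cf2`, width seat `bsd-line-cf2-p1-w2` g11; `--supports stmt-BirchSwinnertonDyer-20368` (helper, Theses-free).
HONEST FRAMING: nothing here closes a crux or a stub; BSD is not proved by any of this; no summit statement is proved by this seat.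
No definition, no named fact, no `sorry`, no kit. beyond-print theorem: no (bookkeeping).

WHY. -w8 g3's (PI) «`v₂ [E(K_v) : E(K)_v + 2^N E(K_v)] = ℓ`» is written with `E(K)_v := (Affine.Point.baseChange (W' := W_K) K K_v).range`
(`E(K) = ((W_K) ⊗_K K)(K)`) and `2^N E(K_v) := (zsmulAddGroupHom (2^N : ℤ)).range` (p677570 / p678401). My p679632
`index_zmultiples_sup_sup_range_eq_of_surjective` gives the `ℤ·P + E[2]` core with `x₀ :=` "`P` read in `K_v`" and `nsmulAddMonoidHom`.
THIS FILE is the dictionary: `range_zsmulAddGroupHom_natCast` (`(zsmulAddGroupHom (n : ℤ)).range = (nsmulAddMonoidHom n).range`),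
`baseChange_congrEquiv_map_ofId` (the base change `K → E` of "`P` read in `K`" IS "`P` read in `E`"), and the restated core
**`index_zmultiples_baseChange_sup_sup_range_eq`**: for `E ≅ ℚ₂` (a surjective `ℚ₂ →+* E`), `P_KK :=` "`P` read in `K`" (an element of
`((W_K) ⊗_K K)(K)`), every 2-power-torsion `C_t ≤ ((W_K) ⊗ E)(E)` with `#C_t = 4` and `N ≥ N₀`:
`[((W_K)⊗E)(E) : ℤ·(baseChange K E P_KK) + C_t + (zsmulAddGroupHom 2^N).range] = 2^{ℓ.toNat}`.

References: J. H. Silverman, *AEC* 2nd ed. (2009), Prop. VII.6.3, VIII §1 [SilvermanAEC2009]; A. Agboola, Compositio 143 (2007) §6 Prop. 6.11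
[Agboola2007].
-/

noncomputable section

open scoped Classical

set_option linter.dupNamespace false -- `Summit.BirchSwinnertonDyer.BirchSwinnertonDyer` (summit = problem) is the tree's layout
set_option autoImplicit false

open NumberField IsDedekindDomain Field WeierstrassCurve
open Literature.NumberTheory.EllipticCurves

namespace Summit.BirchSwinnertonDyer.BirchSwinnertonDyer.Theorems.PrintCf2.LocalLineCount

/-- `(zsmulAddGroupHom (n : ℤ)).range = (nsmulAddMonoidHom n).range`. [folklore] -/
theorem range_zsmulAddGroupHom_natCast {A : Type*} [AddCommGroup A] (n : ℕ) :
    (zsmulAddGroupHom (n : ℤ) : A →+ A).range = (nsmulAddMonoidHom n : A →+ A).range := by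
  ext a
  simp only [AddMonoidHom.mem_range, zsmulAddGroupHom_apply, nsmulAddMonoidHom_apply, natCast_zsmul]

/-- **"`P` read in `K`, then base-changed to `E`" = "`P` read in `E`".** For `W/ℚ`, `K ⊆ E` fields over `ℚ`, `P ∈ W(ℚ)`:
`Affine.Point.baseChange K E (congrEquiv h₁ (map (ofId ℚ K) P)) = congrEquiv h₂ (map (ofId ℚ E) P)` (`h₁ : W_K = (W_K)_K`, `h₂ : W_E = (W_K)_E`).
[cite: SilvermanAEC2009, VIII §1] -/
theorem baseChange_congrEquiv_map_ofId (W : WeierstrassCurve ℚ) (K : Type) [Field K] [CharZero K]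
    (E : Type) [Field E] [Algebra ℚ E] [Algebra K E] [CharZero E]
    (h₁ : W.baseChange K = (W.baseChange K).baseChange K) (h₂ : W.baseChange E = (W.baseChange K).baseChange E) (P : W.toAffine.Point) :
    Affine.Point.baseChange (W' := (W.baseChange K).toAffine) K E
        (Affine.Point.congrEquiv h₁ (Affine.Point.map (W' := W.toAffine) (Algebra.ofId ℚ K) P)) =
      Affine.Point.congrEquiv h₂ (Affine.Point.map (W' := W.toAffine) (Algebra.ofId ℚ E) P) := by
  have hKE : ∀ q : ℚ, algebraMap K E (algebraMap ℚ K q) = algebraMap ℚ E q := fun q ↦ by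
    rw [← RingHom.comp_apply]; exact congrArg (fun f : ℚ →+* E ↦ f q) (Subsingleton.elim _ _)
  rcases P with _ | ⟨x, y, h⟩
  · change Affine.Point.baseChange K E (Affine.Point.congrEquiv h₁ 0) = Affine.Point.congrEquiv h₂ 0
    rw [map_zero, map_zero, map_zero]
  · obtain ⟨hK', eK⟩ : ∃ h', Affine.Point.map (W' := W.toAffine) (Algebra.ofId ℚ K) (.some x y h) =
        .some (algebraMap ℚ K x) (algebraMap ℚ K y) h' :=
      ⟨_, Affine.Point.map_some (W' := W.toAffine) (Algebra.ofId ℚ K) h⟩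
    obtain ⟨hE', eE⟩ : ∃ h', Affine.Point.map (W' := W.toAffine) (Algebra.ofId ℚ E) (.some x y h) =
        .some (algebraMap ℚ E x) (algebraMap ℚ E y) h' :=
      ⟨_, Affine.Point.map_some (W' := W.toAffine) (Algebra.ofId ℚ E) h⟩
    have e1 := congrArg
      (fun Q ↦ Affine.Point.baseChange (W' := (W.baseChange K).toAffine) K E (Affine.Point.congrEquiv h₁ Q)) eK
    have e2 := congrArg (fun Q ↦ Affine.Point.congrEquiv h₂ Q) eE
    refine e1.trans (Eq.trans ?_ e2.symm)
    rw [Affine.Point.congrEquiv_some, Affine.Point.congrEquiv_some]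
    obtain ⟨hKE', eKE⟩ : ∃ h', Affine.Point.baseChange (W' := (W.baseChange K).toAffine) K E
        (.some (algebraMap ℚ K x) (algebraMap ℚ K y) (by assumption)) =
        .some (algebraMap K E (algebraMap ℚ K x)) (algebraMap K E (algebraMap ℚ K y)) h' :=
      ⟨_, Affine.Point.map_some (W' := (W.baseChange K).toAffine) (Algebra.ofId K E) (by assumption)⟩
    exact eKE.trans (Affine.Point.some_eq_some_of_eq (hKE x) (hKE y))

/-- **THE POINT-INDEX CORE in -w8 g3's currency.** `W/ℚ` with the S3c frame data (`d`, `C`, `P`, `c₀`, `ℓ`), `K` a field over `ℚ`, `E ≅ ℚ₂`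
(`φ : ℚ₂ →+* E` surjective; on the frame `E := v.adicCompletion K`, -w6 g3 `exists_surjective_padic_adicCompletion`), `P_KK := congrEquiv h₁
(map (ofId ℚ K) P) ∈ ((W_K)⊗_K K)(K)`: there is `N₀` with, for all `N ≥ N₀` and all 2-power-torsion `C_t ≤ ((W_K)⊗E)(E)`, `#C_t = 4`:
**`[((W_K)⊗E)(E) : ℤ·(Affine.Point.baseChange K E P_KK) + C_t + (zsmulAddGroupHom 2^N).range] = 2^{ℓ.toNat}`.** What (PI) still needs on
top: `E(K)`'s full image lies in `ℤ·P + E[2]` mod `2^N` (𝒪_K-multiples: -w6 g3 p673604; the torsion discrepancy `πP_v − cP_v ∈ W*(K_v) = W*(K)`: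
-w3 g10's CM-scalar line). [cite: SilvermanAEC2009, Prop. VII.6.3 and VIII §1] [cite: Agboola2007, §6 Prop. 6.10–6.11] -/
theorem index_zmultiples_baseChange_sup_sup_range_eq {d : ℤ} (hd : d ≠ 0) (hsq : Squarefree d) (hd4 : d % 4 ≠ 1)
    (W : WeierstrassCurve ℚ) [W.IsElliptic] [W.IsGloballyMinimal] {C : VariableChange ℚ}
    (hC : C • W = cm7.quadraticTwist (d : ℚ)) (K : Type) [Field K] [CharZero K]
    (E : Type) [Field E] [Algebra ℚ E] [Algebra K E] [CharZero E] (φ : ℚ_[2] →+* E) (hφ : Function.Surjective φ)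
    (h₁ : W.baseChange K = (W.baseChange K).baseChange K) (h₂ : W.baseChange E = (W.baseChange K).baseChange E)
    {P : W.toAffine.Point} {c₀ : ℕ} {ℓ : ℤ} (hc₀ : c₀ ≠ 0)
    (hker : (W.baseChange ℚ_[2]).IsInReductionKernel (c₀ • W.toPadicPoint 2 P))
    (hℓ : ‖(W.baseChange ℚ_[2]).padicLogPoint (c₀ • W.toPadicPoint 2 P) / (c₀ : ℚ_[2])‖ = (2 : ℝ) ^ (-ℓ)) :
    ∃ N₀ : ℕ, ∀ N : ℕ, N₀ ≤ N → ∀ Ct : AddSubgroup ((W.baseChange K).baseChange E).toAffine.Point,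
      (∀ c ∈ Ct, ∃ k : ℕ, 2 ^ k • c = 0) → Nat.card Ct = 4 →
      ((AddSubgroup.zmultiples (Affine.Point.baseChange (W' := (W.baseChange K).toAffine) K E
            (Affine.Point.congrEquiv h₁ (Affine.Point.map (W' := W.toAffine) (Algebra.ofId ℚ K) P))) ⊔ Ct) ⊔
          (zsmulAddGroupHom ((2 ^ N : ℕ) : ℤ) : ((W.baseChange K).baseChange E).toAffine.Point →+ _).range).index =
        2 ^ ℓ.toNat := by
  obtain ⟨N₀, hN₀⟩ := index_zmultiples_sup_sup_range_eq_of_surjective hd hsq hd4 W hC K E φ hφ h₂.symm hc₀ hker hℓ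
  refine ⟨N₀, fun N hN Ct hCt hcard ↦ ?_⟩
  rw [baseChange_congrEquiv_map_ofId W K E h₁ h₂ P, range_zsmulAddGroupHom_natCast]
  exact hN₀ N hN Ct hCt hcard

end Summit.BirchSwinnertonDyer.BirchSwinnertonDyer.Theorems.PrintCf2.LocalLineCount

end
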